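import Summits.QuantumFields.BalabanUV.Beta.EriceRemainderEnclosureHistoryAutonomyComparisonStepExact

/-!
# EriceRemainderEnclosureHistoryAutonomyComparisonNonlinearRowPrep — (E118a) preparations for THE NONLINEAR ROW INEQUALITY of the comparison column
# ((E118b) `…ComparisonNonlinearRow.row_ge`): the lemmas that turn the EXACT orbit identity of (E117c) into a signed, differenced inequality in which only
# CUMULATIVE configuration gaps enter.  Base memory AFFINE, `B u = β₀ + Σ_{k<K} L_k·u_k` (`β₀ > 0`, `L ≥ 0`, `L_0 = 0`), perturbation `B′ ≥ B` isotone with floor,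
# modulus, and an excess `B′ − B` with its own modulus `ME ≥ 0` along ordered pairs (`ME = 0` for the constant excess `B′ = B + η`); solution families `S`, `S′`;
# base orbit `h = S y`; CONFIGURATION `n` = the pair (`h(n+·)`, `S′(h_n)`), `δ^{(n)}_j = 1∕S′(h_n)_j² − 1∕h_{n+j}²` its level gap at depth `j`.
# (i) **`heating_le`** — moving the base point of a gap of FIXED LEVEL SIZE `δ` from `x′` up to `x ≥ x′` raises it by at most `(x³∕2 − x′³∕2)·δ` (the rate decay of
# (E116b), derivative-free: with `p = x∕y`, `p² = 1 + δx²`, the defect `b(p) = (p²−1)∕2 − (1 − 1∕p)` is non-negative and non-decreasing);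
# (ii) **`step_eq_drop`** — the step quantity `X_n = B′(S′h_n) − B(S h_n)` is the excess `(B′−B)(S′h_n)` minus the affine drop `Σ_k L_k(h_{n+k} − S′(h_n)_k)`;
# (iii) **`pinSens_le`** — the pin sensitivity of `Φ_{B′} = B′∘S′` across a level gap `δ` below a COMPARED pin `q` is at most `(Σ_{1≤k<K} L_k(S q)_k³∕2 + ME·q³∕2)·δ`
# (the two `B′`-solutions are ordered, (E48a) `le_of_pin_le`; their level gaps never exceed the pin gap, (E63a) `levelGap_le_pin_gap`; coupling gap ≤ cube∕2 × level
# gap; cubes read on the base orbit by comparison);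
# (iv) **`conf_sandwich`** — `δ^{(n)}_{k+1} ≤ δ^{(n)}_1 + δ^{(n+1)}_k` (two `B′`-solutions from the ordered pins `S′(h_n)_1 ≤ h_{n+1}`) — this REPLACES the statement (α)
# «configuration gaps are non-decreasing in depth» of `HOME/b2b-balaban-beta-d4-p2/g97/README.md` §4 (1), which is FALSE for steep excesses (below the threshold
# of a steep excess the configuration sees no excess and its level gap DECREASES);
# (v) **`conf_first_le_step`** — `0 ≤ δ^{(n)}_1 ≤ X_{n+1}`;  (vi) **`conf_incr_ge`** — THE DAMPING DEFECT: `δ^{(c)}_k − δ^{(c)}_{k+1} ≤ (F(c+1+k) + ME·h³_{c+1+k}∕2)·δ^{(c)}_k`,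
# `F(m) = Σ_{1≤q<K} L_q h_{m+q}³∕2`, because EXACTLY `δ_{k+1} − δ_k = X_{c+1+k} − PS′` (autonomy) with `PS′ ≤ (…)·δ_{k+1}` by (iii).  No smallness anywhere.

Cell `pub-balaban`, β-function sub-cell, BINDER row D4 «RemainderConst leaves for Bałaban's split» (`HOME/BINDER-OWNERS.md`; owner lineage `b2b-balaban-beta-an4`;
this file by co-owner #2 lineage `b2b-balaban-beta-d4-p2`, generation 98), β-FLOW TEAM duty (1), FREEZE (0) honoured (def-free; imports (E117c) `…ComparisonStepExact`;
uses (E63a) `levelGap_le_pin_gap`, (E48a) `le_of_pin_le` ∕ `family_tail_eq` ∕ `family_mem` ∕ `family_zero` ∕ `strictAnti_of_memFlow`, node U2's `MemFlow` ∕ `SeqBox` ∕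
`Sharpness.abs_sub_le_half_cube_mul` ∕ `one_div_sq_one_div_sqrt` BY NAME; nothing restated).

HONEST FRAMING (page 1, verbatim and binding).  *"Discharging BetaPertH makes Bałaban's UV stability UNCONDITIONAL — a real constructive-QFT result; it is
NOT the continuum limit and NOT the Clay problem."*  THIS FILE DISCHARGES NOTHING OF THE KIND.  Elementary real analysis about ABSTRACT functionals on a box
]0,γ]^ℕ with displayed floors, moduli, profiles and signs — hypotheses of a census, not facts; the form, signs, ages and moments of Bałaban's (1.22) limit
functional are NOT PRINTED ([I] p. 298; GAPS G-t4-U2-1∕-2) and NOT asserted.  Row D4 class UNCHANGED (critical-path width 0; instance 0∕1; D4 DISCHARGE NO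
DATE).  HONEST DEPENDENCY: continuum YM on T⁴ ⇐ BetaPertH ∧ nine spine estimates (0/9 proved); BetaPertH ⇐ (D1) ∧ (D4) ∧ CAP+tail; G-an2-4 gates asym, D1
and NE2/3/4.  NOT CLAIMED here: any comparison theorem; anything printed — NOT B12 Thm 2, NOT BetaPertH, NOT continuum, NOT Clay.

WHAT IS PROVED ([folklore]; 0 `def`, 0 sorry).  §1 `inv_sqrt_facts`, **`heating_le`**, `sum_range_eq_Ico_of_zero`.  §2 `affine_facts`, **`step_eq_drop`**, **`pinSens_le`**.
§3 **`conf_sandwich`**, **`conf_first_le_step`**, **`conf_incr_ge`**.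
-/
noncomputable section
open Finset Set

namespace Summit.QuantumFields.BalabanUV.Beta.EriceRemainderEnclosureHistoryAutonomyComparisonNonlinearRowPrep

open Literature.MathematicalPhysics.QuantumFieldTheory.Balaban1983to89
open Literature.MathematicalPhysics.QuantumFieldTheory.Balaban1983to89.T4BetaStationary
open Literature.MathematicalPhysics.QuantumFieldTheory.Balaban1983to89.T4BetaFlowWellPosed
open Literature.MathematicalPhysics.QuantumFieldTheory.Balaban1983to89.T4BetaFlowWellPosed.Sharpness (abs_sub_le_half_cube_mul)
open Summit.QuantumFields.BalabanUV.Beta.EriceRemainderEnclosureHistoryAutonomyOrder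
  (family_mem family_tail_eq family_zero le_of_pin_le strictAnti_of_memFlow)
open Summit.QuantumFields.BalabanUV.Beta.EriceRemainderEnclosureHistoryAutonomyComparisonDropBound (levelGap_le_pin_gap)

/-! ## §1 Two facts about the gap of a fixed level size -/

/-- The point `1∕√(1∕x′² + δ)` lowered from `x′ > 0` by the level gap `δ ≥ 0`: it is positive, at most `x′`, and its level is `1∕x′² + δ`. [folklore] -/
theorem inv_sqrt_facts {x' δ : ℝ} (hx' : 0 < x') (hδ : 0 ≤ δ) :
    0 < 1 / Real.sqrt (1 / x' ^ 2 + δ) ∧ 1 / Real.sqrt (1 / x' ^ 2 + δ) ≤ x'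
      ∧ 1 / (1 / Real.sqrt (1 / x' ^ 2 + δ)) ^ 2 = 1 / x' ^ 2 + δ := by
  have hS : 0 < 1 / x' ^ 2 + δ := by positivity
  refine ⟨by positivity, ?_, one_div_sq_one_div_sqrt hS⟩
  rw [div_le_iff₀ (Real.sqrt_pos.mpr hS)]
  have h1 : 1 / x' ≤ Real.sqrt (1 / x' ^ 2 + δ) := by
    rw [show (1 : ℝ) / x' = Real.sqrt ((1 / x') ^ 2) by rw [Real.sqrt_sq (by positivity)]]
    exact Real.sqrt_le_sqrt (by rw [div_pow, one_pow]; linarith)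
  have := mul_le_mul_of_nonneg_left h1 hx'.le
  rwa [mul_one_div_cancel hx'.ne'] at this

/-- **THE HEATING OF A GAP OF FIXED LEVEL SIZE (derivative-free rate decay).**  `0 < x′ ≤ x`, `δ ≥ 0`, `y`, `y′ > 0` the points below `x`, `x′` at the
level gap `δ` (`1∕y² = 1∕x² + δ`, `1∕y′² = 1∕x′² + δ`).  Then `(x − y) − (x′ − y′) ≤ (x³∕2 − x′³∕2)·δ`.  (With `p = x∕y`, `q = x′∕y′`: `p² = 1 + δx²`,
`q² = 1 + δx′²`, `p ≥ q ≥ 1`, and the claim is `x′·b(q) ≤ x·b(p)` for the non-negative non-decreasing `b(p) = (p²−1)∕2 − (1 − 1∕p)`.) [folklore] -/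
theorem heating_le {x x' y y' δ : ℝ} (hx' : 0 < x') (hxx' : x' ≤ x) (hδ : 0 ≤ δ) (hy : 0 < y) (hy' : 0 < y')
    (hlev : 1 / y ^ 2 = 1 / x ^ 2 + δ) (hlev' : 1 / y' ^ 2 = 1 / x' ^ 2 + δ) :
    (x - y) - (x' - y') ≤ (x ^ 3 / 2 - x' ^ 3 / 2) * δ := by
  have hx : 0 < x := hx'.trans_le hxx'
  set p : ℝ := x / y with hp_def
  set q : ℝ := x' / y' with hq_def
  have hp0 : 0 < p := div_pos hx hy
  have hq0 : 0 < q := div_pos hx' hy'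
  -- p² = 1 + δ x², q² = 1 + δ x'²
  have hp2 : p ^ 2 = 1 + δ * x ^ 2 := by
    have e : p ^ 2 = x ^ 2 * (1 / y ^ 2) := by rw [hp_def, div_pow]; ring
    rw [e, hlev]; field_simp
  have hq2 : q ^ 2 = 1 + δ * x' ^ 2 := by
    have e : q ^ 2 = x' ^ 2 * (1 / y' ^ 2) := by rw [hq_def, div_pow]; ring
    rw [e, hlev']; field_simp
  have hq1 : 1 ≤ q := by nlinarith [mul_nonneg hδ (sq_nonneg x')]
  have hpq : q ≤ p := by
    have : q ^ 2 ≤ p ^ 2 := by rw [hp2, hq2]; nlinarith [mul_le_mul_of_nonneg_left (pow_le_pow_left₀ hx'.le hxx' 2) hδ]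
    exact (pow_le_pow_iff_left₀ hq0.le hp0.le two_ne_zero).1 this
  have hp1 : 1 ≤ p := hq1.trans hpq
  -- y = x/p, y' = x'/q
  have hyx : y = x / p := by rw [hp_def]; field_simp
  have hy'x : y' = x' / q := by rw [hq_def]; field_simp
  -- b(q) ≥ 0 and b(q) ≤ b(p), cleared of denominators
  have hbq0 : 0 ≤ (q ^ 2 - 1) / 2 - (1 - 1 / q) := by
    have e : (q ^ 2 - 1) / 2 - (1 - 1 / q) = (q - 1) * (q * (q + 1) / 2 - 1) / q := by field_simp; ring
    rw [e]; apply div_nonneg _ hq0.le; apply mul_nonneg (by linarith); nlinarith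
  have hbmono : (q ^ 2 - 1) / 2 - (1 - 1 / q) ≤ (p ^ 2 - 1) / 2 - (1 - 1 / p) := by
    have e : ((p ^ 2 - 1) / 2 - (1 - 1 / p)) - ((q ^ 2 - 1) / 2 - (1 - 1 / q)) = (p - q) * (p * q * (p + q) / 2 - 1) / (p * q) := by
      field_simp; ring
    have : 0 ≤ (p - q) * (p * q * (p + q) / 2 - 1) / (p * q) := by
      apply div_nonneg _ (by positivity); apply mul_nonneg (by linarith); nlinarith [mul_le_mul hp1 hq1 zero_le_one hp0.le]
    linarith
  -- the claim: x'·b(q) ≤ x·b(p)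
  have key : x' * ((q ^ 2 - 1) / 2 - (1 - 1 / q)) ≤ x * ((p ^ 2 - 1) / 2 - (1 - 1 / p)) :=
    (mul_le_mul_of_nonneg_right hxx' hbq0).trans (mul_le_mul_of_nonneg_left hbmono hx.le)
  have e1 : x - y = x * (1 - 1 / p) := by rw [hyx]; ring
  have e2 : x' - y' = x' * (1 - 1 / q) := by rw [hy'x]; ring
  have e3 : (x ^ 3 / 2 - x' ^ 3 / 2) * δ = x * ((p ^ 2 - 1) / 2) - x' * ((q ^ 2 - 1) / 2) := by rw [hp2, hq2]; ring
  rw [e1, e2, e3]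
  nlinarith [key]

/-- A sum over `range K` whose `k = 0` term vanishes is the sum over `Ico 1 K`. [folklore] -/
theorem sum_range_eq_Ico_of_zero {f : ℕ → ℝ} (h0 : f 0 = 0) {K : ℕ} : ∑ k ∈ range K, f k = ∑ k ∈ Ico 1 K, f k := by
  cases K with
  | zero => simp
  | succ K' => rw [range_eq_Ico, sum_eq_sum_Ico_succ_bot (by omega), h0, zero_add]

/-! ## §2 The affine base memory: the step quantity is the excess minus the drop; the pin sensitivity of the perturbed effective β-function -/

variable {B B' : (ℕ → ℝ) → ℝ} {γ β₀ b' M' ME : ℝ} {L : ℕ → ℝ} {K : ℕ} {S S' : ℝ → ℕ → ℝ}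

/-- The affine memory `β₀ + Σ_{k<K} L_k·u_k` (`β₀ > 0`, `L ≥ 0`) on the box: isotone, floor `β₀`, dominating its profile, zeroth moment `Σ_k L_k`. [folklore] -/
theorem affine_facts (hBaff : ∀ u, SeqBox γ u → B u = β₀ + ∑ k ∈ range K, L k * u k) (hL : ∀ k, 0 ≤ L k) (hβ : 0 < β₀) :
    (∀ u v : ℕ → ℝ, SeqBox γ u → SeqBox γ v → (∀ j, u j ≤ v j) → B u ≤ B v)
      ∧ (∀ u, SeqBox γ u → β₀ ≤ B u) ∧ (∀ u, SeqBox γ u → ∑ k ∈ range K, L k * u k ≤ B u)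
      ∧ (∀ u u' : ℕ → ℝ, SeqBox γ u → SeqBox γ u' → ∀ D : ℝ, (∀ j, |u j - u' j| ≤ D) → |B u - B u'| ≤ (∑ k ∈ range K, L k) * D) := by
  refine ⟨fun u v hu hv hle => ?_, fun u hu => ?_, fun u hu => ?_, fun u u' hu hu' D hD => ?_⟩
  · rw [hBaff u hu, hBaff v hv]
    exact add_le_add le_rfl (sum_le_sum fun k _ => mul_le_mul_of_nonneg_left (hle k) (hL k))
  · rw [hBaff u hu]; exact le_add_of_nonneg_right (sum_nonneg fun k _ => mul_nonneg (hL k) (hu k).1.le)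
  · rw [hBaff u hu]; linarith
  · rw [hBaff u hu, hBaff u' hu', add_sub_add_left_eq_sub, ← sum_sub_distrib, sum_mul]
    refine (abs_sum_le_sum_abs _ _).trans (sum_le_sum fun k _ => ?_)
    rw [← mul_sub, abs_mul, abs_of_nonneg (hL k)]
    exact mul_le_mul_of_nonneg_left (hD k) (hL k)

/-- **THE STEP QUANTITY IS THE EXCESS MINUS THE AFFINE DROP.**  At the orbit pin `h_n = S y n`:
`B′(S′h_n) − B(S h_n) = (B′ − B)(S′h_n) − Σ_{k<K} L_k·(h_{n+k} − S′(h_n)_k)` (autonomy: `S(h_n) = h(n+·)`). [folklore] -/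
theorem step_eq_drop (hBaff : ∀ u, SeqBox γ u → B u = β₀ + ∑ k ∈ range K, L k * u k)
    (hS : ∀ p, 0 < p → p ≤ γ → SeqBox γ (S p) ∧ MemFlow B p (S p))
    (huniq : ∀ p, 0 < p → p ≤ γ → ∀ u u' : ℕ → ℝ, SeqBox γ u → SeqBox γ u' → MemFlow B p u → MemFlow B p u' → u = u')
    (hS' : ∀ p, 0 < p → p ≤ γ → SeqBox γ (S' p) ∧ MemFlow B' p (S' p))
    {y : ℝ} (hy : 0 < y) (hyγ : y ≤ γ) (n : ℕ) :
    B' (S' (S y n)) - B (S (S y n))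
      = (B' (S' (S y n)) - B (S' (S y n))) - ∑ k ∈ range K, L k * (S y (n + k) - S' (S y n) k) := by
  have hq := family_mem hS hy hyγ n
  have htail : S (S y n) = fun j => S y (n + j) := (family_tail_eq hS huniq hy hyγ n).symm
  have hbS : SeqBox γ (S (S y n)) := (hS _ hq.1 hq.2).1
  have hbS' : SeqBox γ (S' (S y n)) := (hS' _ hq.1 hq.2).1
  rw [hBaff _ hbS, hBaff _ hbS', htail]
  have e : ∑ k ∈ range K, L k * (S y (n + k) - S' (S y n) k)
      = ∑ k ∈ range K, L k * S y (n + k) - ∑ k ∈ range K, L k * S' (S y n) k := by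
    rw [← sum_sub_distrib]; exact sum_congr rfl fun k _ => by ring
  rw [e]; ring

/-- **THE PIN SENSITIVITY OF THE PERTURBED EFFECTIVE β-FUNCTION IS AT MOST (FIRST-ENTRY SUM + EXCESS MODULUS × CUBE) × LEVEL GAP.**  `B` affine as displayed
(`L_0 = 0`); `B′` with floor `b′ > 0`, modulus `M′`, and an excess `B′ − B` with modulus `ME ≥ 0` along ordered pairs; pins `0 < q′ ≤ q ≤ γ` with `q` COMPARED
(`S′q ≤ S q` at every scale).  Then `B′(S′q) − B′(S′q′) ≤ (Σ_{1≤k<K} L_k(S q)_k³∕2 + ME·q³∕2)·(1∕q′² − 1∕q²)` — the two `B′`-solutions are ordered by the pins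
((E48a) `le_of_pin_le`), their level gaps never exceed the pin gap ((E63a) `levelGap_le_pin_gap`), each coupling gap is at most cube∕2 × level gap, and the
cubes are read on the base orbit by comparison. [folklore] -/
theorem pinSens_le (hBaff : ∀ u, SeqBox γ u → B u = β₀ + ∑ k ∈ range K, L k * u k) (hL : ∀ k, 0 ≤ L k) (hL0 : L 0 = 0)
    (hmono' : ∀ u v : ℕ → ℝ, SeqBox γ u → SeqBox γ v → (∀ j, u j ≤ v j) → B' u ≤ B' v) (hb' : 0 < b')
    (hB' : ∀ u u' : ℕ → ℝ, SeqBox γ u → SeqBox γ u' → ∀ D : ℝ, (∀ j, |u j - u' j| ≤ D) → |B' u - B' u'| ≤ M' * D) (hM' : 0 ≤ M')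
    (hlo' : ∀ u, SeqBox γ u → b' ≤ B' u)
    (hEmod : ∀ u u' : ℕ → ℝ, SeqBox γ u → SeqBox γ u' → (∀ j, u' j ≤ u j) → ∀ D : ℝ, 0 ≤ D → (∀ j, u j - u' j ≤ D) →
      (B' u - B u) - (B' u' - B u') ≤ ME * D)
    (hS : ∀ p, 0 < p → p ≤ γ → SeqBox γ (S p) ∧ MemFlow B p (S p))
    (hS' : ∀ p, 0 < p → p ≤ γ → SeqBox γ (S' p) ∧ MemFlow B' p (S' p))
    (huniq' : ∀ p, 0 < p → p ≤ γ → ∀ u u' : ℕ → ℝ, SeqBox γ u → SeqBox γ u' → MemFlow B' p u → MemFlow B' p u' → u = u')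
    {q q' : ℝ} (hq' : 0 < q') (hq'q : q' ≤ q) (hqγ : q ≤ γ) (hcmp : ∀ j, S' q j ≤ S q j) :
    B' (S' q) - B' (S' q') ≤ (∑ k ∈ Ico 1 K, L k * S q k ^ 3 / 2 + ME * q ^ 3 / 2) * (1 / q' ^ 2 - 1 / q ^ 2) := by
  have hq : 0 < q := hq'.trans_le hq'q
  have hq'γ : q' ≤ γ := hq'q.trans hqγ
  obtain ⟨hk, hfk⟩ := hS' q hq hqγ
  obtain ⟨hk', hfk'⟩ := hS' q' hq' hq'γ
  have hkS : SeqBox γ (S q) := (hS q hq hqγ).1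
  set δ : ℝ := 1 / q' ^ 2 - 1 / q ^ 2 with hδ_def
  have hδ0 : 0 ≤ δ := sub_nonneg.mpr (one_div_le_one_div_of_le (pow_pos hq' 2) (pow_le_pow_left₀ hq'.le hq'q 2))
  -- the two B′-solutions are ordered, their level gaps are ≤ δ, their coupling gaps ≤ (S q j)³/2 · δ ≤ q³/2 · δ
  have hle : ∀ j, S' q' j ≤ S' q j := fun j => le_of_pin_le hb' hB' hM' hlo' huniq' hq' hq'q hqγ hk' hk hfk' hfk j
  have hlg : ∀ j, 1 / S' q' j ^ 2 - 1 / S' q j ^ 2 ≤ δ := levelGap_le_pin_gap hmono' hk hfk hk' hfk' hle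
  have hgap : ∀ j, S' q j - S' q' j ≤ S' q j ^ 3 / 2 * δ := by
    intro j
    have h1 := (hk j).1; have h2 := (hk' j).1
    have hw := abs_sub_le_half_cube_mul h1 h2 le_rfl (hle j)
    have hg0 : 0 ≤ S' q j - S' q' j := by linarith [hle j]
    have hd0 : 0 ≤ 1 / S' q' j ^ 2 - 1 / S' q j ^ 2 :=
      sub_nonneg.mpr (one_div_le_one_div_of_le (pow_pos h2 2) (pow_le_pow_left₀ h2.le (hle j) 2))
    rw [abs_of_nonneg hg0, abs_sub_comm, abs_of_nonneg hd0] at hw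
    exact hw.trans (mul_le_mul_of_nonneg_left (hlg j) (by positivity))
  have hpin : ∀ j, S' q j ≤ q := fun j => by
    have := (strictAnti_of_memFlow hb' hlo' hk hfk).antitone (Nat.zero_le j); rwa [hfk.1] at this
  have hgapq : ∀ j, S' q j - S' q' j ≤ q ^ 3 / 2 * δ := fun j =>
    (hgap j).trans (mul_le_mul_of_nonneg_right (by
      have := pow_le_pow_left₀ (hk j).1.le (hpin j) 3; linarith) hδ0)
  -- the B-part, read through the affine profile on the base orbit
  have hBpart : B (S' q) - B (S' q') ≤ (∑ k ∈ Ico 1 K, L k * S q k ^ 3 / 2) * δ := by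
    rw [hBaff _ hk, hBaff _ hk', add_sub_add_left_eq_sub, ← sum_sub_distrib, sum_mul]
    rw [sum_range_eq_Ico_of_zero (f := fun k => L k * S' q k - L k * S' q' k) (by simp [hL0])]
    refine sum_le_sum fun k _ => ?_
    have hc := hcmp k
    have h3 : S' q k ^ 3 ≤ S q k ^ 3 := pow_le_pow_left₀ (hk k).1.le hc 3
    calc L k * S' q k - L k * S' q' k = L k * (S' q k - S' q' k) := by ring
      _ ≤ L k * (S' q k ^ 3 / 2 * δ) := mul_le_mul_of_nonneg_left (hgap k) (hL k)
      _ ≤ L k * (S q k ^ 3 / 2 * δ) := mul_le_mul_of_nonneg_left (mul_le_mul_of_nonneg_right (by linarith) hδ0) (hL k)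
      _ = L k * S q k ^ 3 / 2 * δ := by ring
  -- the excess part
  have hEpart : (B' (S' q) - B (S' q)) - (B' (S' q') - B (S' q')) ≤ ME * (q ^ 3 / 2 * δ) :=
    hEmod _ _ hk hk' hle _ (by positivity) hgapq
  have : B' (S' q) - B' (S' q') = (B (S' q) - B (S' q')) + ((B' (S' q) - B (S' q)) - (B' (S' q') - B (S' q'))) := by ring
  rw [this]
  nlinarith [hBpart, hEpart]

/-! ## §3 Configurations along the base orbit: the sandwich, the first increment, the damping defect -/

/-- **THE CONFIGURATION SANDWICH.**  Base orbit `h = S y`; configuration `n` = `S′(h_n)`, configuration `n+1` = `S′(h_{n+1})`; comparison at depth one in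
configuration `n` (`S′(h_n)_1 ≤ h_{n+1}`).  Then at every depth `k`:
`1∕S′(h_n)_{k+1}² − 1∕S′(h_{n+1})_k² ≤ 1∕S′(h_n)_1² − 1∕h_{n+1}²` — the level gap of configuration `n` at the absolute scale `n+1+k` exceeds that of configuration
`n+1` there by at most its own FIRST increment (two `B′`-solutions from the ordered pins `S′(h_n)_1 ≤ h_{n+1}`; (E63a) `levelGap_le_pin_gap`). [folklore] -/
theorem conf_sandwich (hmono' : ∀ u v : ℕ → ℝ, SeqBox γ u → SeqBox γ v → (∀ j, u j ≤ v j) → B' u ≤ B' v) (hb' : 0 < b')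
    (hB' : ∀ u u' : ℕ → ℝ, SeqBox γ u → SeqBox γ u' → ∀ D : ℝ, (∀ j, |u j - u' j| ≤ D) → |B' u - B' u'| ≤ M' * D) (hM' : 0 ≤ M')
    (hlo' : ∀ u, SeqBox γ u → b' ≤ B' u)
    (hS : ∀ p, 0 < p → p ≤ γ → SeqBox γ (S p) ∧ MemFlow B p (S p))
    (hS' : ∀ p, 0 < p → p ≤ γ → SeqBox γ (S' p) ∧ MemFlow B' p (S' p))
    (huniq' : ∀ p, 0 < p → p ≤ γ → ∀ u u' : ℕ → ℝ, SeqBox γ u → SeqBox γ u' → MemFlow B' p u → MemFlow B' p u' → u = u')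
    {y : ℝ} (hy : 0 < y) (hyγ : y ≤ γ) (n : ℕ) (hcmp1 : S' (S y n) 1 ≤ S y (n + 1)) (k : ℕ) :
    1 / S' (S y n) (k + 1) ^ 2 - 1 / S' (S y (n + 1)) k ^ 2 ≤ 1 / S' (S y n) 1 ^ 2 - 1 / S y (n + 1) ^ 2 := by
  have hz := family_mem hS hy hyγ (n + 1)
  have hq := family_mem hS hy hyγ n
  have hz' := family_mem hS' hq.1 hq.2 1
  have htail : (fun j => S' (S y n) (1 + j)) = S' (S' (S y n) 1) := family_tail_eq hS' huniq' hq.1 hq.2 1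
  have hk := hS' _ hz.1 hz.2
  have hk' := hS' _ hz'.1 hz'.2
  have hle : ∀ j, S' (S' (S y n) 1) j ≤ S' (S y (n + 1)) j := fun j =>
    le_of_pin_le hb' hB' hM' hlo' huniq' hz'.1 hcmp1 hz.2 hk'.1 hk.1 hk'.2 hk.2 j
  have htail' : ∀ j, S' (S y n) (1 + j) = S' (S' (S y n) 1) j := fun j => congrFun htail j
  have := levelGap_le_pin_gap hmono' hk.1 hk.2 hk'.1 hk'.2 hle k
  have e : S' (S' (S y n) 1) k = S' (S y n) (k + 1) := by rw [← htail' k, show 1 + k = k + 1 from Nat.add_comm 1 k]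
  rwa [e] at this

/-- **THE FIRST INCREMENT OF A CONFIGURATION IS AT MOST THE STEP QUANTITY ONE PIN DEEPER** (and non-negative): with comparison at depth one in configuration `n`,
`0 ≤ 1∕S′(h_n)_1² − 1∕h_{n+1}² ≤ B′(S′h_{n+1}) − B(S h_{n+1})` (the difference is the perturbed pin sensitivity between `S′(h_n)_1 ≤ h_{n+1}`). [folklore] -/
theorem conf_first_le_step (hmono' : ∀ u v : ℕ → ℝ, SeqBox γ u → SeqBox γ v → (∀ j, u j ≤ v j) → B' u ≤ B' v) (hb' : 0 < b')
    (hB' : ∀ u u' : ℕ → ℝ, SeqBox γ u → SeqBox γ u' → ∀ D : ℝ, (∀ j, |u j - u' j| ≤ D) → |B' u - B' u'| ≤ M' * D) (hM' : 0 ≤ M')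
    (hlo' : ∀ u, SeqBox γ u → b' ≤ B' u)
    (hS : ∀ p, 0 < p → p ≤ γ → SeqBox γ (S p) ∧ MemFlow B p (S p))
    (huniq : ∀ p, 0 < p → p ≤ γ → ∀ u u' : ℕ → ℝ, SeqBox γ u → SeqBox γ u' → MemFlow B p u → MemFlow B p u' → u = u')
    (hS' : ∀ p, 0 < p → p ≤ γ → SeqBox γ (S' p) ∧ MemFlow B' p (S' p))
    (huniq' : ∀ p, 0 < p → p ≤ γ → ∀ u u' : ℕ → ℝ, SeqBox γ u → SeqBox γ u' → MemFlow B' p u → MemFlow B' p u' → u = u')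
    {y : ℝ} (hy : 0 < y) (hyγ : y ≤ γ) (n : ℕ) (hcmp1 : S' (S y n) 1 ≤ S y (n + 1)) :
    0 ≤ 1 / S' (S y n) 1 ^ 2 - 1 / S y (n + 1) ^ 2
      ∧ 1 / S' (S y n) 1 ^ 2 - 1 / S y (n + 1) ^ 2 ≤ B' (S' (S y (n + 1))) - B (S (S y (n + 1))) := by
  have hz := family_mem hS hy hyγ (n + 1)
  have hq := family_mem hS hy hyγ n
  have hz' := family_mem hS' hq.1 hq.2 1
  refine ⟨sub_nonneg.mpr (one_div_le_one_div_of_le (pow_pos hz'.1 2) (pow_le_pow_left₀ hz'.1.le hcmp1 2)), ?_⟩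
  have hf := (hS y hy hyγ).2
  have hf' := (hS' _ hq.1 hq.2).2
  have e1 : 1 / S' (S y n) 1 ^ 2 = 1 / S y n ^ 2 + B' (S' (S' (S y n) 1)) := by
    rw [← family_tail_eq hS' huniq' hq.1 hq.2 1, show (1 : ℕ) = 0 + 1 from rfl, hf'.2 0, hf'.1]
  have e2 : 1 / S y (n + 1) ^ 2 = 1 / S y n ^ 2 + B (S (S y (n + 1))) := by
    rw [← family_tail_eq hS huniq hy hyγ (n + 1), hf.2 n]
  have hk := hS' _ hz.1 hz.2
  have hk' := hS' _ hz'.1 hz'.2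
  have hle : ∀ j, S' (S' (S y n) 1) j ≤ S' (S y (n + 1)) j := fun j =>
    le_of_pin_le hb' hB' hM' hlo' huniq' hz'.1 hcmp1 hz.2 hk'.1 hk.1 hk'.2 hk.2 j
  have := hmono' _ _ hk'.1 hk.1 hle
  rw [e1, e2]; linarith

/-- **THE DAMPING DEFECT: A CONFIGURATION'S LEVEL GAP DROPS BETWEEN CONSECUTIVE DEPTHS BY AT MOST (FIRST-ENTRY SUM + EXCESS MODULUS × CUBE) × ITSELF.**
Configuration `c` (pin `h_c`), depth `k`; comparison in configuration `c` and from the deeper orbit pin `h_{c+1+k}`, and the step quantity non-negative there.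
With `δ_j = 1∕S′(h_c)_j² − 1∕h_{c+j}²`:  `δ_k − δ_{k+1} ≤ (Σ_{1≤q<K} L_q·h_{c+1+k+q}³∕2 + ME·h_{c+1+k}³∕2)·δ_k` — since EXACTLY `δ_{k+1} − δ_k = X_{c+1+k} − PS′` (autonomy)
with the pin sensitivity `PS′ ≤ (…)·δ_{k+1}` by `pinSens_le`. [folklore] -/
theorem conf_incr_ge (hBaff : ∀ u, SeqBox γ u → B u = β₀ + ∑ k ∈ range K, L k * u k) (hL : ∀ k, 0 ≤ L k) (hL0 : L 0 = 0)
    (hmono' : ∀ u v : ℕ → ℝ, SeqBox γ u → SeqBox γ v → (∀ j, u j ≤ v j) → B' u ≤ B' v) (hb' : 0 < b')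
    (hB' : ∀ u u' : ℕ → ℝ, SeqBox γ u → SeqBox γ u' → ∀ D : ℝ, (∀ j, |u j - u' j| ≤ D) → |B' u - B' u'| ≤ M' * D) (hM' : 0 ≤ M')
    (hlo' : ∀ u, SeqBox γ u → b' ≤ B' u)
    (hEmod : ∀ u u' : ℕ → ℝ, SeqBox γ u → SeqBox γ u' → (∀ j, u' j ≤ u j) → ∀ D : ℝ, 0 ≤ D → (∀ j, u j - u' j ≤ D) →
      (B' u - B u) - (B' u' - B u') ≤ ME * D) (hME : 0 ≤ ME)
    (hS : ∀ p, 0 < p → p ≤ γ → SeqBox γ (S p) ∧ MemFlow B p (S p))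
    (huniq : ∀ p, 0 < p → p ≤ γ → ∀ u u' : ℕ → ℝ, SeqBox γ u → SeqBox γ u' → MemFlow B p u → MemFlow B p u' → u = u')
    (hS' : ∀ p, 0 < p → p ≤ γ → SeqBox γ (S' p) ∧ MemFlow B' p (S' p))
    (huniq' : ∀ p, 0 < p → p ≤ γ → ∀ u u' : ℕ → ℝ, SeqBox γ u → SeqBox γ u' → MemFlow B' p u → MemFlow B' p u' → u = u')
    {y : ℝ} (hy : 0 < y) (hyγ : y ≤ γ) (c k : ℕ) (hcmpc : ∀ j, S' (S y c) j ≤ S y (c + j))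
    (hcmpm : ∀ j, S' (S y (c + 1 + k)) j ≤ S y (c + 1 + k + j)) (hXm : 0 ≤ B' (S' (S y (c + 1 + k))) - B (S (S y (c + 1 + k)))) :
    (1 / S' (S y c) k ^ 2 - 1 / S y (c + k) ^ 2) - (1 / S' (S y c) (k + 1) ^ 2 - 1 / S y (c + k + 1) ^ 2)
      ≤ (∑ q ∈ Ico 1 K, L q * S y (c + 1 + k + q) ^ 3 / 2 + ME * S y (c + 1 + k) ^ 3 / 2)
          * (1 / S' (S y c) k ^ 2 - 1 / S y (c + k) ^ 2) := by
  have hqc := family_mem hS hy hyγ c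
  have hqm := family_mem hS hy hyγ (c + 1 + k)
  have hw := hS' _ hqc.1 hqc.2
  have hwk := family_mem hS' hqc.1 hqc.2 (k + 1)
  have hf := (hS y hy hyγ).2
  -- the increment of the configuration's level gap is X − PS′, exactly
  have e1 : 1 / S' (S y c) (k + 1) ^ 2 = 1 / S' (S y c) k ^ 2 + B' (S' (S' (S y c) (k + 1))) := by
    rw [← family_tail_eq hS' huniq' hqc.1 hqc.2 (k + 1), hw.2.2 k]
  have e2 : 1 / S y (c + k + 1) ^ 2 = 1 / S y (c + k) ^ 2 + B (S (S y (c + 1 + k))) := by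
    rw [← family_tail_eq hS huniq hy hyγ (c + 1 + k), hf.2 (c + k), show c + k + 1 = c + 1 + k by ring]
  set δk : ℝ := 1 / S' (S y c) k ^ 2 - 1 / S y (c + k) ^ 2 with hδk
  set θ : ℝ := ∑ q ∈ Ico 1 K, L q * S y (c + 1 + k + q) ^ 3 / 2 + ME * S y (c + 1 + k) ^ 3 / 2 with hθ
  have hθ0 : 0 ≤ θ := by
    have : ∀ q, 0 ≤ L q * S y (c + 1 + k + q) ^ 3 / 2 := fun q => by
      have := hL q; have := (family_mem hS hy hyγ (c + 1 + k + q)).1; positivity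
    exact add_nonneg (sum_nonneg fun q _ => this q) (by have := hqm.1; have := hME; positivity)
  have hδk0 : 0 ≤ δk := sub_nonneg.mpr (one_div_le_one_div_of_le (pow_pos (family_mem hS' hqc.1 hqc.2 k).1 2)
    (pow_le_pow_left₀ (family_mem hS' hqc.1 hqc.2 k).1.le (hcmpc k) 2))
  -- the pin sensitivity between S′(h_c)_{k+1} ≤ h_{c+1+k}
  have hq'q : S' (S y c) (k + 1) ≤ S y (c + 1 + k) := by have := hcmpc (k + 1); rwa [show c + (k + 1) = c + 1 + k by ring] at this
  have etail : ∀ q, S y (c + 1 + k + q) = S (S y (c + 1 + k)) q := fun q => congrFun (family_tail_eq hS huniq hy hyγ (c + 1 + k)) q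
  have hcmpm' : ∀ j, S' (S y (c + 1 + k)) j ≤ S (S y (c + 1 + k)) j := fun j => by rw [← etail j]; exact hcmpm j
  have hps := pinSens_le hBaff hL hL0 hmono' hb' hB' hM' hlo' hEmod hS hS' huniq' hwk.1 hq'q hqm.2 hcmpm'
  simp only [← etail] at hps
  -- δ_{k+1} = δ_k + X − PS′ and PS′ ≤ θ·δ_{k+1}
  have hX := hXm
  have key : (1 / S' (S y c) (k + 1) ^ 2 - 1 / S y (c + k + 1) ^ 2)
      = δk + (B' (S' (S y (c + 1 + k))) - B (S (S y (c + 1 + k))))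
          - (B' (S' (S y (c + 1 + k))) - B' (S' (S' (S y c) (k + 1)))) := by rw [e1, e2, hδk]; ring
  have hgap' : 1 / S' (S y c) (k + 1) ^ 2 - 1 / S y (c + 1 + k) ^ 2 = 1 / S' (S y c) (k + 1) ^ 2 - 1 / S y (c + k + 1) ^ 2 := by
    rw [show c + 1 + k = c + k + 1 by ring]
  rw [hgap'] at hps
  -- ε(1+θ) ≥ X − θ δ_k ≥ −θ δ_k
  set ε : ℝ := (1 / S' (S y c) (k + 1) ^ 2 - 1 / S y (c + k + 1) ^ 2) - δk with hε
  have h1 : -(θ * δk) ≤ ε * (1 + θ) := by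
    have : ε = (B' (S' (S y (c + 1 + k))) - B (S (S y (c + 1 + k))))
        - (B' (S' (S y (c + 1 + k))) - B' (S' (S' (S y c) (k + 1)))) := by rw [hε, key]; ring
    have hps' : B' (S' (S y (c + 1 + k))) - B' (S' (S' (S y c) (k + 1))) ≤ θ * (δk + ε) := by
      have : 1 / S' (S y c) (k + 1) ^ 2 - 1 / S y (c + k + 1) ^ 2 = δk + ε := by rw [hε]; ring
      rw [← this]; exact hps
    nlinarith
  have goal : δk - (δk + ε) ≤ θ * δk := by
    by_cases hε0 : 0 ≤ ε
    · nlinarith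
    · have hε0 := lt_of_not_ge hε0; nlinarith
  have e3 : 1 / S' (S y c) (k + 1) ^ 2 - 1 / S y (c + k + 1) ^ 2 = δk + ε := by rw [hε]; ring
  rw [e3]; exact goal

end Summit.QuantumFields.BalabanUV.Beta.EriceRemainderEnclosureHistoryAutonomyComparisonNonlinearRowPrep

end
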